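import Summits.NavierStokesRegularity.FunctionalMining.TopEigSimpleTopPersist
import Summits.NavierStokesRegularity.FunctionalMining.TopEigDensityIdentity
import HarnessLib

/-!
# FunctionalMining — the density identity AT A SIMPLE POINT of the strain field, with no eigenpair
# input: directional first and second derivatives of `λ₁(S(v))` (F1 PART I, Proposition 3)

Search for candidate a priori estimates; no regularity claim. Cell `pub-nsfunc`, prove seat
(gen 22). For a smooth field `v` on `T³` and a point `x` where the top strain eigenvalue is SIMPLE in
gap form (`S(x)e = λe`, `|e| = 1`, `wᵀS(x)w ≤ (λ − g)|w|²` on `e^⊥`, `g > 0`), the restriction of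
`S(v)` to every coordinate line through `x` is an entrywise `C^∞` symmetric family, so
`TopEigSimpleTopPersist.hasDerivAt_lam1_of_gapForm` applies: with NO smooth-eigenpair hypothesis,

* **`TopEig.partialDeriv_torusStrainTopEig_of_gapForm`** — `∂ₖλ₁(x) = eᵀ S(∂ₖv)(x) e`;
* **`TopEig.partialDeriv_partialDeriv_torusStrainTopEig_of_gapForm`** — there is a vector `N′`
  (the derivative of the continued unit top eigenvector along the line) with
  `∂ₖ∂ₖλ₁(x) = eᵀ S(∂ₖ∂ₖv)(x) e + 2 N′ᵀ S(∂ₖv)(x) e` and `N′ᵀS(∂ₖv)(x)e = λ|N′|² − N′ᵀS(x)N′ ≥ 0`;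
* **`TopEig.sum_partialDeriv_partialDeriv_torusStrainTopEig_ge`** — summing over `k`:
  `∑ₖ ∂ₖ∂ₖλ₁(x) ≥ eᵀ S(Δv)(x) e`, i.e. the density seen by `e₁` satisfies
  `ρ_{e₁}(x) = −qλ₁^{q−1}e₁ᵀΔS e₁ ≥ −qλ₁^{q−1} ∑ₖ∂ₖ∂ₖλ₁(x)` — Prop. 3's identity (2) at the point, in
  directional form (the sum `∑ₖ∂ₖ∂ₖλ₁` is the torus Laplacian of `λ₁` wherever `λ₁` is smooth
  around `x`; that joint smoothness is not asserted here).

Here `∂ₖ` is the cell's `Torus.partialDeriv` (the derivative along `t ↦ x + t eₖ` at `t = 0`).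
[ours; folklore]
-/

noncomputable section

open Filter Topology Matrix
open scoped ContDiff

namespace Summit.NavierStokesRegularity.FunctionalMining

open Literature.Analysis Literature.Analysis.FunctionSpaces Literature.Analysis.FunctionSpaces.Torus
  SharpClass.DirectorForm

namespace TopEig

variable {v : UnitAddTorus (Fin 3) → EuclideanSpace ℝ (Fin 3)}

/-! ## 1. The strain along a coordinate line is an entrywise smooth symmetric family -/

/-- Along the coordinate line `t ↦ x + t eₖ`, a smooth torus function is `C^∞` in `t`. [folklore] -/
theorem contDiff_coordLine {F : Type*} [NormedAddCommGroup F] [NormedSpace ℝ F] {d : Type*} [Fintype d]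
    {f : UnitAddTorus d → F} (hf : Torus.IsSmooth f) (x : UnitAddTorus d) (K : EuclideanSpace ℝ d) :
    ContDiff ℝ ∞ fun t : ℝ => f (x + proj (t • K)) := by
  have h : (fun t : ℝ => f (x + proj (t • K))) = liftAt f x ∘ fun t : ℝ => t • K := by
    funext t; rfl
  rw [h]
  exact (hf.liftAt x).comp (contDiff_id.smul contDiff_const)

/-- `λ₁` of the strain matrix is the dictionary's `torusStrainTopEig`. [ours, bookkeeping] -/
theorem lam1_torusStrainMatrix {d : Type*} [Fintype d] [DecidableEq d] [Nonempty d]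
    (w : UnitAddTorus d → EuclideanSpace ℝ d) (y : UnitAddTorus d) :
    lam1 (torusStrainMatrix w y) = torusStrainTopEig w y := by
  unfold lam1
  rw [flat_torusStrainMatrix, lam_strainFlat]

/-- The line shift: `x + proj(t eₖ) + proj(s eₖ) = x + proj((t + s) eₖ)`. [folklore] -/
theorem coordLine_add {d : Type*} (x : UnitAddTorus d) (K : EuclideanSpace ℝ d) (t s : ℝ) :
    x + proj (t • K) + proj (s • K) = x + proj ((t + s) • K) := by
  rw [add_smul, proj_add, add_assoc]

/-! ## 2. Directional derivatives of `λ₁(S(v))` at a simple point -/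

/-- **PROPOSITION 3 AT A SIMPLE POINT, no eigenpair input.** For a smooth field `v` on `T³`, a point
`x` with the top strain eigenvalue simple in gap form at the unit vector `e`, and a coordinate
direction `k`: there is a vector `N′ ∈ ℝ³` such that
`∂ₖλ₁(x) = eᵀS(∂ₖv)(x)e`, `∂ₖ∂ₖλ₁(x) = eᵀS(∂ₖ∂ₖv)(x)e + 2N′ᵀS(∂ₖv)(x)e`, and
`N′ᵀS(∂ₖv)(x)e = λ|N′|² − N′ᵀS(x)N′ ≥ 0`. [ours; F1 PART I Prop. 3] -/
theorem partialDeriv_partialDeriv_torusStrainTopEig_of_gapForm (hv : Torus.IsSmooth v)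
    {x : UnitAddTorus (Fin 3)} {e : Fin 3 → ℝ} {lam g : ℝ} (he1 : e ⬝ᵥ e = 1)
    (hSe : torusStrainMatrix v x *ᵥ e = lam • e) (hg : 0 < g)
    (hgap : ∀ w, w ⬝ᵥ e = 0 → w ⬝ᵥ torusStrainMatrix v x *ᵥ w ≤ (lam - g) * (w ⬝ᵥ w))
    (k : Fin 3) :
    ∃ N' : Fin 3 → ℝ,
      Torus.partialDeriv k (torusStrainTopEig v) x = e ⬝ᵥ (torusStrainMatrix (Torus.partialDeriv k v) x *ᵥ e) ∧
      Torus.partialDeriv k (Torus.partialDeriv k (torusStrainTopEig v)) x =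
        e ⬝ᵥ (torusStrainMatrix (Torus.partialDeriv k (Torus.partialDeriv k v)) x *ᵥ e) +
          2 * (N' ⬝ᵥ (torusStrainMatrix (Torus.partialDeriv k v) x *ᵥ e)) ∧
      N' ⬝ᵥ (torusStrainMatrix (Torus.partialDeriv k v) x *ᵥ e) =
        lam * (N' ⬝ᵥ N') - N' ⬝ᵥ (torusStrainMatrix v x *ᵥ N') ∧
      0 ≤ N' ⬝ᵥ (torusStrainMatrix (Torus.partialDeriv k v) x *ᵥ e) := by
  set K : EuclideanSpace ℝ (Fin 3) := EuclideanSpace.single k (1 : ℝ) with hK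
  -- the family along the line
  set L : ℝ → Matrix (Fin 3) (Fin 3) ℝ := fun t => torusStrainMatrix v (x + proj (t • K)) with hL
  have hLs : ∀ i j, ContDiff ℝ ∞ fun t => L t i j := fun i j =>
    contDiff_coordLine (isSmooth_torusStrainMatrix_entry hv i j) x K
  have hLsymm : ∀ t, (L t).IsSymm := fun t => torusStrainMatrix_isSymm v _
  have hL0 : L 0 = torusStrainMatrix v x := by simp only [hL, coordLine_zero]
  have hSe' : L 0 *ᵥ e = lam • e := by rw [hL0]; exact hSe
  have hgap' : ∀ w, w ⬝ᵥ e = 0 → w ⬝ᵥ L 0 *ᵥ w ≤ (lam - g) * (w ⬝ᵥ w) := by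
    intro w hw; rw [hL0]; exact hgap w hw
  obtain ⟨N, Λ, hN, hΛ, hN0, hΛ0, hev, hHF, hD2Λ, hchan, hsign⟩ :=
    hasDerivAt_top_eigenpair hLs hLsymm he1 hSe' hg hgap'
  -- the continued eigenvalue IS `λ₁ ∘ L` near `0`
  have hpers := eventually_top_eigenpair hLs hLsymm he1 hSe' hg hgap' hN hΛ hN0 hΛ0 hev
  have heq : (fun θ => lam1 (L θ)) =ᶠ[𝓝 0] Λ := hpers.mono fun θ h => h.1
  have hD1 := hHF.congr_of_eventuallyEq heq
  have heq' : deriv (fun θ => lam1 (L θ)) =ᶠ[𝓝 0] deriv Λ := by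
    filter_upwards [heq.eventually_nhds] with θ hθ
    exact Filter.EventuallyEq.deriv_eq (hθ : (fun θ => lam1 (L θ)) =ᶠ[𝓝 θ] Λ)
  have hD2 := hD2Λ.congr_of_eventuallyEq heq'
  -- identify the entrywise derivatives of `L` at `0`
  have hd1 : ∀ i j, deriv (fun t => L t i j) 0 = torusStrainMatrix (Torus.partialDeriv k v) x i j := by
    intro i j
    have h := (hasDerivAt_coordLine (isSmooth_torusStrainMatrix_entry hv i j) x k 0).deriv
    rw [coordLine_zero, partialDeriv_strainEntry hv] at h
    exact h
  have hd1fun : ∀ i j, deriv (fun t => L t i j) =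
      fun t => torusStrainMatrix (Torus.partialDeriv k v) (x + proj (t • K)) i j := by
    intro i j
    funext t
    have h := (hasDerivAt_coordLine (isSmooth_torusStrainMatrix_entry hv i j) x k t).deriv
    rw [partialDeriv_strainEntry hv] at h
    exact h
  have hd2 : ∀ i j, deriv (deriv fun t => L t i j) 0 =
      torusStrainMatrix (Torus.partialDeriv k (Torus.partialDeriv k v)) x i j := by
    intro i j
    rw [hd1fun i j]
    have h := (hasDerivAt_coordLine (isSmooth_torusStrainMatrix_entry (hv.partialDeriv k) i j) x k 0).deriv
    rw [coordLine_zero, partialDeriv_strainEntry (hv.partialDeriv k)] at h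
    exact h
  have hM1 : (Matrix.of fun i j => deriv (fun t => L t i j) 0) =
      torusStrainMatrix (Torus.partialDeriv k v) x := by
    ext i j; rw [Matrix.of_apply, hd1]
  have hM2 : (Matrix.of fun i j => deriv (deriv fun t => L t i j) 0) =
      torusStrainMatrix (Torus.partialDeriv k (Torus.partialDeriv k v)) x := by
    ext i j; rw [Matrix.of_apply, hd2]
  rw [hM1] at hD1 hsign hchan
  rw [hM1, hM2] at hD2
  rw [hL0] at hchan
  -- `λ₁ ∘ L` is the line function of `torusStrainTopEig`
  have hfun : (fun t => lam1 (L t)) = fun t => torusStrainTopEig v (x + proj (t • K)) := by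
    funext t; exact lam1_torusStrainMatrix v _
  rw [hfun] at hD1 hD2
  -- first derivative: `∂ₖλ₁(x)` is by definition `deriv (line function) 0`
  have h1 : Torus.partialDeriv k (torusStrainTopEig v) x =
      e ⬝ᵥ (torusStrainMatrix (Torus.partialDeriv k v) x *ᵥ e) := hD1.deriv
  -- the line function of `∂ₖλ₁` is the derivative of the line function (shift of base point)
  have hshift : (fun t : ℝ => Torus.partialDeriv k (torusStrainTopEig v) (x + proj (t • K))) =
      deriv fun t : ℝ => torusStrainTopEig v (x + proj (t • K)) := by
    funext t
    show deriv (fun s : ℝ => torusStrainTopEig v (x + proj (t • K) +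
      proj (s • EuclideanSpace.single k (1 : ℝ)))) 0 = _
    have hcomp : (fun s : ℝ => torusStrainTopEig v (x + proj (t • K) +
        proj (s • EuclideanSpace.single k (1 : ℝ)))) =
        fun s : ℝ => torusStrainTopEig v (x + proj ((t + s) • K)) := by
      funext s; rw [← hK, coordLine_add]
    rw [hcomp]
    have h := deriv_comp_const_add (f := fun u : ℝ => torusStrainTopEig v (x + proj (u • K)))
      (a := t) (x := (0 : ℝ))
    rw [add_zero] at h
    exact h
  have h2 : Torus.partialDeriv k (Torus.partialDeriv k (torusStrainTopEig v)) x =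
      e ⬝ᵥ (torusStrainMatrix (Torus.partialDeriv k (Torus.partialDeriv k v)) x *ᵥ e) +
        2 * ((fun i => deriv (fun t => N t i) 0) ⬝ᵥ
          (torusStrainMatrix (Torus.partialDeriv k v) x *ᵥ e)) := by
    show deriv (fun t : ℝ => Torus.partialDeriv k (torusStrainTopEig v)
      (x + proj (t • EuclideanSpace.single k (1 : ℝ)))) 0 = _
    rw [← hK, hshift]
    exact hD2.deriv
  exact ⟨fun i => deriv (fun t => N t i) 0, h1, h2, hchan, hsign⟩

/-- **`∂ₖλ₁(x) = eᵀS(∂ₖv)(x)e` at a simple point** (Hellmann–Feynman for the strain's top eigenvalue,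
no eigenpair input). [ours; F1 PART I Prop. 3] -/
theorem partialDeriv_torusStrainTopEig_of_gapForm (hv : Torus.IsSmooth v)
    {x : UnitAddTorus (Fin 3)} {e : Fin 3 → ℝ} {lam g : ℝ} (he1 : e ⬝ᵥ e = 1)
    (hSe : torusStrainMatrix v x *ᵥ e = lam • e) (hg : 0 < g)
    (hgap : ∀ w, w ⬝ᵥ e = 0 → w ⬝ᵥ torusStrainMatrix v x *ᵥ w ≤ (lam - g) * (w ⬝ᵥ w))
    (k : Fin 3) :
    Torus.partialDeriv k (torusStrainTopEig v) x = e ⬝ᵥ (torusStrainMatrix (Torus.partialDeriv k v) x *ᵥ e) := by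
  obtain ⟨-, h1, -, -, -⟩ := partialDeriv_partialDeriv_torusStrainTopEig_of_gapForm hv he1 hSe hg hgap k
  exact h1

/-- **The directional Laplacian of `λ₁` dominates the density seen by `e₁` at a simple point**:
`∑ₖ ∂ₖ∂ₖλ₁(x) ≥ eᵀ S(Δv)(x) e` — so `ρ_{e₁}(x) = −qλ₁^{q−1}e₁ᵀΔS(x)e₁ ≥ −qλ₁^{q−1}∑ₖ∂ₖ∂ₖλ₁(x)`
wherever `λ₁ ≥ 0`, `q ≥ 0`. [ours; F1 PART I Prop. 3 (2) at the point] -/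
theorem sum_partialDeriv_partialDeriv_torusStrainTopEig_ge (hv : Torus.IsSmooth v)
    {x : UnitAddTorus (Fin 3)} {e : Fin 3 → ℝ} {lam g : ℝ} (he1 : e ⬝ᵥ e = 1)
    (hSe : torusStrainMatrix v x *ᵥ e = lam • e) (hg : 0 < g)
    (hgap : ∀ w, w ⬝ᵥ e = 0 → w ⬝ᵥ torusStrainMatrix v x *ᵥ w ≤ (lam - g) * (w ⬝ᵥ w)) :
    e ⬝ᵥ (torusStrainMatrix (Torus.laplacian v) x *ᵥ e) ≤
      ∑ k, Torus.partialDeriv k (Torus.partialDeriv k (torusStrainTopEig v)) x := by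
  have hkey : ∀ k, e ⬝ᵥ (torusStrainMatrix (Torus.partialDeriv k (Torus.partialDeriv k v)) x *ᵥ e) ≤
      Torus.partialDeriv k (Torus.partialDeriv k (torusStrainTopEig v)) x := by
    intro k
    obtain ⟨N', -, h2, -, hsign⟩ := partialDeriv_partialDeriv_torusStrainTopEig_of_gapForm hv he1 hSe hg hgap k
    rw [h2]
    linarith
  have hsum : e ⬝ᵥ (torusStrainMatrix (Torus.laplacian v) x *ᵥ e) =
      ∑ k, e ⬝ᵥ (torusStrainMatrix (Torus.partialDeriv k (Torus.partialDeriv k v)) x *ᵥ e) := by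
    calc e ⬝ᵥ (torusStrainMatrix (Torus.laplacian v) x *ᵥ e)
        = ∑ i, ∑ j, e i * torusStrainMatrix (Torus.laplacian v) x i j * e j :=
          dotProduct_mulVec_eq_sum_sum _ _ _
      _ = ∑ i, ∑ j, ∑ k, e i * torusStrainMatrix (Torus.partialDeriv k (Torus.partialDeriv k v)) x i j * e j := by
          refine Finset.sum_congr rfl fun i _ => Finset.sum_congr rfl fun j _ => ?_
          rw [← torusStrainMatrix_laplacian hv x i j, Finset.mul_sum, Finset.sum_mul]
      _ = ∑ k, ∑ i, ∑ j, e i * torusStrainMatrix (Torus.partialDeriv k (Torus.partialDeriv k v)) x i j * e j := by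
          rw [Finset.sum_congr rfl fun i _ => Finset.sum_comm, Finset.sum_comm]
      _ = ∑ k, e ⬝ᵥ (torusStrainMatrix (Torus.partialDeriv k (Torus.partialDeriv k v)) x *ᵥ e) :=
          Finset.sum_congr rfl fun k _ => (dotProduct_mulVec_eq_sum_sum _ _ _).symm
  rw [hsum]
  exact Finset.sum_le_sum fun k _ => hkey k

end TopEig

end Summit.NavierStokesRegularity.FunctionalMining

end
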